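/-
Copyright (c) 2026 the pub-hodgecm-mathlib formalisation cell (harness21).  Prover seat hodgecm-mathlib-B-p10 (g25), (F11-c) LAYER B′ FILE 3 (iii) — FILE α
(the frame-free counting core), design pen A-p13 (g30), architect A-p06 (g26), 2026-09-01.  FILE 6 of the `UnramifiedQuadraticNorm*` story.
-/
import Literature.NumberTheory.LocalFields.UnramifiedQuadraticNormFixedPoints    -- ★ (L5-c) FILE 1: `natCard_fixed_quotient_pow`, `maximalIdeal_pow_le_comap`, …
import HarnessLib

/-!
# Twisted anti-trace fibres `z − Δ·σz ≡ c (mod 𝔪^k)` for a norm-one twist `Δ`, contraction bijections of `R ⧸ 𝔪^k`, and level lifting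
# (the counting core of Flicker 1998, Prop. 16 p. 96, second row `(q+1)q^{N+2m}`)

Topic `NumberTheory/LocalFields`; namespace `Literature.NumberTheory.LocalFields.UnramifiedQuadraticNorm` (★ (L5-c) FILES 1–5).  THEOREMS ONLY: no definition, no
instance, no notation, no named fact, no `sorry`; kernel lane.  Cell `pub/hodgecm-mathlib`, F0∕P3a road «D-N7-inert» ∕ «N7nsCount» value stub `stub_irredGValueNeg`
(κ = −1), LAYER B′ FILE 3 (iii) «regime `[N∕2] < m ≤ N`» (B-p10 (g25) census `F0/P3a/B-p10/g25/CENSUS-F3iii-RegimeTwoCount.B-p10g25.md`).  HC_CM is proved only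
modulo the printed citations until rung 0 closes; this file is unconditional finite commutative algebra and pays nothing by itself.

SETTING.  `R` a commutative LOCAL ring with a ring involution `σ` moving some element by a unit (`σ a − a ∈ Rˣ`: the unramified quadratic situation of ★ FILE 1);
for the counts `R` is a discrete valuation ring with `|𝓀| = q²`.  NO completeness is used.

THE MATHEMATICS.  In Flicker's own (equal-diagonal) frame [Flicker1998UnitaryFL, Prop. 16 p. 96] the fixed-point congruence of the second row is affine σ-SEMILINEAR
(«`|β + πα(c̄ − c) − δ| ≤ |π|^{1+2m}`», «`#c = q^N`»); in the anisotropic frame of LAYER B′ (★ `UnitaryThreeAnisotropicFixedPointRegimes`) it reads `Λ(Φ(u)) ≡ c (mod 𝔪^k)`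
with a NORM-ONE TWIST `Δ` (`Δ·σΔ = 1`), `Λ(z) := z − Δ·σz`, `Φ` a contraction perturbation of `u ↦ ε·σu`.  The frame-free counting facts that turn that into `q^N`:
* §1 **unit Hilbert 90** `exists_isUnit_eq_mul_map`: `Δ·σΔ = 1 ⇒ Δ = θ ∕ σθ` for a UNIT `θ` (`θ = 1 + Δ`, or `a + Δ·σa` when `1 + Δ ∈ 𝔪`);
* §2 **anti-trace fibres** `natCard_antitrace_fibre_eq`: for `σc + c ∈ I` (`σ(I) ⊆ I`) the classes `w̄` with `σ̄w̄ − w̄ = c̄` form a coset of `Fix(σ̄_I)` (base point `−c·t`,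
  `t + σt = 1`), and **twisted** `natCard_twistedAntitrace_fibre_eq` (`z = θw` turns `z − Δσz` into `θ(w − σw)`); on `R ⧸ 𝔪^k` with `|𝓀| = q²`:
  **`natCard_twistedAntitrace_fibre_quotient_pow`** `#{z̄ : z̄ − Δ̄·σ̄z̄ = c̄} = q^k` when `c + Δσc ∈ 𝔪^k`, and `natCard_twistedAntitrace_fibre_eq_zero` (`= 0` otherwise);
* §3 **contraction bijections** `mk_eq_mk_of_contraction` ∕ `sub_mem_of_contraction` ∕ `natCard_lift_comp_contraction_eq`: a map `Φ : R → R` with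
  `Φu − Φu′ − ε(σu − σu′) ∈ 𝔪^{j+1}` whenever `u − u′ ∈ 𝔪^j` (`ε ∈ Rˣ`) induces a BIJECTION of `R ⧸ 𝔪^k` (injective by induction on the level; finite), so
  `#{ū : C(Φ u)} = #{z̄ : C z}` for every predicate `C` that is constant on classes mod `𝔪^k`;
* §4 **level lifting** `natCard_lift_quotient_pow_eq_mul`: for `k ≤ m` and `C` constant mod `𝔪^k`, `#{x̄ ∈ R ⧸ 𝔪^m : C} = |𝓀|^{m−k} · #{ȳ ∈ R ⧸ 𝔪^k : C}`.

## References
* [Flicker1998UnitaryFL] Y. Z. Flicker, *Elementary proof of the fundamental lemma for a unitary group*, Canad. J. Math. 50 (1998), Prop. 16 p. 96.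
* [Serre1979] J.-P. Serre, *Local Fields*, GTM 67 (1979), Ch. V §2 Prop. 2–3, Ch. X §1 (Hilbert 90).
-/

set_option autoImplicit false

namespace Literature.NumberTheory.LocalFields.UnramifiedQuadraticNorm

open Literature.LinearAlgebra.Matrix.HermitianFormsHensel Literature.NumberTheory.GaloisRepresentations IsLocalRing

universe u

variable {R : Type u} [CommRing R] (σ : R →+* R)

/-! ## §1 Unit Hilbert 90 for a norm-one twist -/

section HilbertNinety

variable [IsLocalRing R] (hσ : ∀ a, σ (σ a) = a) {a : R} (ha : IsUnit (σ a - a))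

omit [IsLocalRing R] in
include hσ in
/-- For `Δ·σΔ = 1` and ANY `x`, the element `θ = x + Δ·σx` satisfies `θ = Δ·σθ`. [cite: Serre1979, Ch. X §1 Prop. 2 (Hilbert 90)] -/
theorem add_mul_map_eq_mul_map {Δ : R} (hΔ : Δ * σ Δ = 1) (x : R) : x + Δ * σ x = Δ * σ (x + Δ * σ x) := by
  rw [map_add, map_mul, hσ]
  linear_combination (-x) * hΔ

include hσ ha in
/-- **Unit Hilbert 90.**  In a local ring with an involution `σ` moving some element by a unit, every `Δ` with `Δ·σΔ = 1` is `θ ∕ σθ` for a UNIT `θ`, i.e.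
`θ = Δ·σθ` with `θ ∈ Rˣ`: take `θ = 1 + Δ` if that is a unit, else (`1 + Δ ∈ 𝔪`) `θ = a + Δ·σa = −(σa − a) + (1 + Δ)σa ∈ −Rˣ + 𝔪 ⊆ Rˣ`.
[cite: Serre1979, Ch. X §1 Prop. 2 (Hilbert 90)] -/
theorem exists_isUnit_eq_mul_map {Δ : R} (hΔ : Δ * σ Δ = 1) : ∃ θ : R, IsUnit θ ∧ θ = Δ * σ θ := by
  by_cases h1 : IsUnit (1 + Δ)
  · refine ⟨1 + Δ, h1, ?_⟩
    have := add_mul_map_eq_mul_map σ hσ hΔ 1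
    rwa [map_one, mul_one] at this
  · refine ⟨a + Δ * σ a, ?_, add_mul_map_eq_mul_map σ hσ hΔ a⟩
    have hm : 1 + Δ ∈ maximalIdeal R := (mem_maximalIdeal _).2 (mem_nonunits_iff.2 h1)
    by_contra hn
    have hm' : a + Δ * σ a ∈ maximalIdeal R := (mem_maximalIdeal _).2 (mem_nonunits_iff.2 hn)
    have hkey : σ a - a = (1 + Δ) * σ a - (a + Δ * σ a) := by ring
    have : σ a - a ∈ maximalIdeal R := by
      rw [hkey]
      exact Ideal.sub_mem _ (Ideal.mul_mem_right _ _ hm) hm'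
    exact (mem_nonunits_iff.1 ((mem_maximalIdeal _).1 this)) ha

omit [IsLocalRing R] in
include hσ in
/-- If `θ = Δ·σθ` and `Δ·σΔ = 1` then `σθ = σΔ·θ` (apply `σ`). [cite: Serre1979, Ch. X §1] -/
theorem map_eq_map_mul_of_eq_mul_map {Δ θ : R} (hθ : θ = Δ * σ θ) : σ θ = σ Δ * θ := by
  conv_lhs => rw [hθ]
  rw [map_mul, hσ]

end HilbertNinety

/-! ## §2 Anti-trace fibres and their twisted form -/

section Fibres

variable [IsLocalRing R] (hσ : ∀ a, σ (σ a) = a) {a : R} (ha : IsUnit (σ a - a)) {I : Ideal R} (hI : I ≤ I.comap σ)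

include hσ ha in
/-- **Anti-trace fibres are cosets of the fixed classes.**  For `σc + c ∈ I` (an anti-fixed class) the set `{w̄ ∈ R ⧸ I : σ̄w̄ − w̄ = c̄}` is in bijection with
`Fix(σ̄_I)`: it contains `w̄₀ = −c̄·t̄` (`t + σt = 1`, ★ `exists_add_map_eq_one_of_isUnit_sub`; `σ(−ct) + ct = −σt(σc + c) + … ≡ c`) and is its `Fix`-coset.
[cite: Serre1979, Ch. V §2 Prop. 2] [cite: Flicker1998UnitaryFL, Prop. 16 p. 96] -/
theorem natCard_antitrace_fibre_eq {c : R} (hc : σ c + c ∈ I) :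
    Nat.card {w : R ⧸ I // Ideal.quotientMap I σ hI w - w = Ideal.Quotient.mk I c} =
      Nat.card {x : R ⧸ I // Ideal.quotientMap I σ hI x = x} := by
  obtain ⟨t, ht⟩ := exists_add_map_eq_one_of_isUnit_sub σ hσ ha
  set σq := Ideal.quotientMap I σ hI with hσq
  have hσq_mk : ∀ x : R, σq (Ideal.Quotient.mk I x) = Ideal.Quotient.mk I (σ x) := fun x => Ideal.quotientMap_mk
  set w₀ : R ⧸ I := Ideal.Quotient.mk I (-(c * t)) with hw₀
  have hbase : σq w₀ - w₀ = Ideal.Quotient.mk I c := by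
    rw [hw₀, hσq_mk, ← map_sub, Ideal.Quotient.eq]
    have hst : σ t = 1 - t := by rw [← ht]; ring
    have e : σ (-(c * t)) - -(c * t) - c = -(σ t) * (σ c + c) := by
      rw [map_neg, map_mul, hst]; ring
    rw [e]
    exact I.mul_mem_left _ hc
  have hb : σq w₀ = Ideal.Quotient.mk I c + w₀ := sub_eq_iff_eq_add.1 hbase
  refine Nat.card_congr
    { toFun := fun w => ⟨w.1 - w₀, ?_⟩
      invFun := fun x => ⟨x.1 + w₀, ?_⟩
      left_inv := fun w => Subtype.ext (sub_add_cancel _ _)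
      right_inv := fun x => Subtype.ext (add_sub_cancel_right _ _) }
  · have hw : σq w.1 - w.1 = Ideal.Quotient.mk I c := w.2
    have hw' : σq w.1 = Ideal.Quotient.mk I c + w.1 := sub_eq_iff_eq_add.1 hw
    show σq (w.1 - w₀) = w.1 - w₀
    rw [map_sub, hw', hb]; ring
  · have hx : σq x.1 = x.1 := x.2
    show σq (x.1 + w₀) - (x.1 + w₀) = Ideal.Quotient.mk I c
    rw [map_add, hx, hb]; ring

omit [IsLocalRing R] in
include hσ hI in
/-- If `z − Δσz − c ∈ I` is solvable then `c + Δσc ∈ I` (apply `w ↦ Δ·σw`, which negates `z − Δσz` when `ΔσΔ = 1`). [cite: Flicker1998UnitaryFL, Prop. 16 p. 96] -/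
theorem add_mul_map_mem_of_sub_mem {Δ : R} (hΔ : Δ * σ Δ = 1) {z c : R} (hz : z - Δ * σ z - c ∈ I) : c + Δ * σ c ∈ I := by
  have h1 : Δ * σ (z - Δ * σ z - c) ∈ I := I.mul_mem_left _ (hI hz)
  have e : c + Δ * σ c = -(z - Δ * σ z - c) - Δ * σ (z - Δ * σ z - c) := by
    rw [map_sub, map_sub, map_mul, hσ]
    linear_combination (-z) * hΔ
  rw [e]
  exact I.sub_mem (I.neg_mem hz) h1

include hσ ha in
/-- **Twisted anti-trace fibres.**  For `Δ·σΔ = 1` and `c + Δσc ∈ I`: `#{z̄ ∈ R ⧸ I : z̄ − Δ̄·σ̄z̄ = c̄} = #Fix(σ̄_I)` — with a unit `θ = Δ·σθ` (§1), `z = θw` gives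
`z − Δσz = θ(w − σw)`, so `z̄ ↦ θ̄⁻¹z̄` is a bijection onto the anti-trace fibre over `−θ⁻¹c` (anti-fixed: `σ(θ⁻¹) = Δ·θ⁻¹`), counted by `natCard_antitrace_fibre_eq`.
[cite: Serre1979, Ch. V §2 Prop. 2, Ch. X §1 Prop. 2] [cite: Flicker1998UnitaryFL, Prop. 16 p. 96] -/
theorem natCard_twistedAntitrace_fibre_eq {Δ : R} (hΔ : Δ * σ Δ = 1) {c : R} (hc : c + Δ * σ c ∈ I) :
    Nat.card {z : R ⧸ I // z - Ideal.Quotient.mk I Δ * Ideal.quotientMap I σ hI z = Ideal.Quotient.mk I c} =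
      Nat.card {x : R ⧸ I // Ideal.quotientMap I σ hI x = x} := by
  obtain ⟨θ, hθu, hθ⟩ := exists_isUnit_eq_mul_map σ hσ ha hΔ
  obtain ⟨θu, rfl⟩ := hθu
  set σq := Ideal.quotientMap I σ hI with hσq
  have hσq_mk : ∀ x : R, σq (Ideal.Quotient.mk I x) = Ideal.Quotient.mk I (σ x) := fun x => Ideal.quotientMap_mk
  -- `σ(θ⁻¹) = Δ θ⁻¹`
  have hσθ : σ (θu : R) = σ Δ * θu := map_eq_map_mul_of_eq_mul_map σ hσ hθ
  have hσθi : σ (↑θu⁻¹ : R) = Δ * ↑θu⁻¹ := by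
    have h1 : σ (↑θu⁻¹ : R) * σ (θu : R) = 1 := by rw [← map_mul, Units.inv_mul, map_one]
    rw [hσθ] at h1
    -- h1 : σ ↑θu⁻¹ * (σ Δ * ↑θu) = 1
    calc σ (↑θu⁻¹ : R) = σ (↑θu⁻¹ : R) * (σ Δ * ↑θu) * (Δ * ↑θu⁻¹) := by
          rw [mul_assoc, show σ Δ * (θu : R) * (Δ * ↑θu⁻¹) = (Δ * σ Δ) * ((θu : R) * ↑θu⁻¹) by ring, hΔ, Units.mul_inv, mul_one, mul_one]
      _ = Δ * ↑θu⁻¹ := by rw [h1, one_mul]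
  -- the anti-fixed target `c′ = −θ⁻¹ c`
  have hc' : σ (-(↑θu⁻¹ * c)) + -(↑θu⁻¹ * c) ∈ I := by
    have e : σ (-(↑θu⁻¹ * c)) + -(↑θu⁻¹ * c) = -(↑θu⁻¹ : R) * (c + Δ * σ c) := by
      rw [map_neg, map_mul, hσθi]; ring
    rw [e]; exact I.mul_mem_left _ hc
  rw [← natCard_antitrace_fibre_eq σ hσ ha hI hc']
  set θb : R ⧸ I := Ideal.Quotient.mk I θu with hθb
  set θbi : R ⧸ I := Ideal.Quotient.mk I (↑θu⁻¹ : R) with hθbi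
  have hθθi : θb * θbi = 1 := by rw [hθb, hθbi, ← map_mul, Units.mul_inv, map_one]
  have hσqθ : Ideal.Quotient.mk I Δ * σq θb = θb := by
    rw [hθb, hσq_mk, ← map_mul, ← hθ]
  -- key identity: `θ w − Δ̄ σ̄(θ w) = θ (w − σ̄ w)`
  have key : ∀ w : R ⧸ I, θb * w - Ideal.Quotient.mk I Δ * σq (θb * w) = θb * (w - σq w) := fun w => by
    rw [map_mul, ← mul_assoc, hσqθ]; ring
  refine Nat.card_congr
    { toFun := fun z => ⟨θbi * z.1, ?_⟩
      invFun := fun w => ⟨θb * w.1, ?_⟩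
      left_inv := fun z => Subtype.ext (by
        show θb * (θbi * z.1) = z.1
        rw [← mul_assoc, hθθi, one_mul])
      right_inv := fun w => Subtype.ext (by
        show θbi * (θb * w.1) = w.1
        rw [← mul_assoc, mul_comm θbi, hθθi, one_mul]) }
  · have hz : z.1 - Ideal.Quotient.mk I Δ * σq z.1 = Ideal.Quotient.mk I c := z.2
    have hzw : θb * (θbi * z.1) = z.1 := by rw [← mul_assoc, hθθi, one_mul]
    have h1 : θb * (θbi * z.1 - σq (θbi * z.1)) = Ideal.Quotient.mk I c := by rw [← key, hzw]; exact hz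
    have h2 : θbi * z.1 - σq (θbi * z.1) = θbi * Ideal.Quotient.mk I c := by
      calc θbi * z.1 - σq (θbi * z.1) = (θbi * θb) * (θbi * z.1 - σq (θbi * z.1)) := by rw [mul_comm θbi θb, hθθi, one_mul]
        _ = θbi * (θb * (θbi * z.1 - σq (θbi * z.1))) := by rw [mul_assoc]
        _ = θbi * Ideal.Quotient.mk I c := by rw [h1]
    have h3 : θbi * Ideal.Quotient.mk I c = Ideal.Quotient.mk I (↑θu⁻¹ * c) := by rw [hθbi, ← map_mul]
    show σq (θbi * z.1) - θbi * z.1 = Ideal.Quotient.mk I (-(↑θu⁻¹ * c))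
    rw [map_neg, ← h3, ← h2]; ring
  · have hw : σq w.1 - w.1 = Ideal.Quotient.mk I (-(↑θu⁻¹ * c)) := w.2
    have h3 : -Ideal.Quotient.mk I (-(↑θu⁻¹ * c)) = θbi * Ideal.Quotient.mk I c := by rw [hθbi, ← map_mul, ← map_neg, neg_neg]
    have h2 : w.1 - σq w.1 = θbi * Ideal.Quotient.mk I c := by
      have e : w.1 - σq w.1 = -(σq w.1 - w.1) := by ring
      rw [e, hw, h3]
    show θb * w.1 - Ideal.Quotient.mk I Δ * σq (θb * w.1) = Ideal.Quotient.mk I c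
    rw [key, h2, ← mul_assoc, hθθi, one_mul]

omit [IsLocalRing R] in
include hσ hI in
/-- If `c + Δσc ∉ I` the twisted fibre is EMPTY. [cite: Flicker1998UnitaryFL, Prop. 16 p. 96] -/
theorem isEmpty_twistedAntitrace_fibre {Δ : R} (hΔ : Δ * σ Δ = 1) {c : R} (hc : c + Δ * σ c ∉ I) :
    IsEmpty {z : R ⧸ I // z - Ideal.Quotient.mk I Δ * Ideal.quotientMap I σ hI z = Ideal.Quotient.mk I c} := by
  refine ⟨fun z => hc ?_⟩
  obtain ⟨z, hz⟩ := z
  obtain ⟨z, rfl⟩ := Ideal.Quotient.mk_surjective z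
  rw [Ideal.quotientMap_mk, ← map_mul, ← map_sub, Ideal.Quotient.eq] at hz
  exact add_mul_map_mem_of_sub_mem σ hσ hI hΔ hz

end Fibres

section FibresDVR

variable [IsDomain R] [IsDiscreteValuationRing R] (hσ : ∀ a, σ (σ a) = a) {a : R} (ha : IsUnit (σ a - a))
  {q : ℕ} (hq : Nat.card (ResidueField R) = q ^ 2)

include hσ ha hq in
/-- **`#{z̄ ∈ R ⧸ 𝔪^k : z̄ − Δ̄·σ̄z̄ = c̄} = q^k`** for `Δ·σΔ = 1` and `c + Δσc ∈ 𝔪^k`, when `|𝓀| = q²` (twisted fibre ≃ `Fix(σ̄_k)`, ★ `natCard_fixed_quotient_pow`).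
[cite: Flicker1998UnitaryFL, Prop. 16 p. 96] [cite: Serre1979, Ch. V §2 Prop. 2–3] -/
theorem natCard_twistedAntitrace_fibre_quotient_pow {Δ : R} (hΔ : Δ * σ Δ = 1) (k : ℕ) {c : R} (hc : c + Δ * σ c ∈ maximalIdeal R ^ k) :
    Nat.card {z : R ⧸ maximalIdeal R ^ k //
        z - Ideal.Quotient.mk _ Δ * Ideal.quotientMap (maximalIdeal R ^ k) σ (maximalIdeal_pow_le_comap σ hσ k) z = Ideal.Quotient.mk _ c} = q ^ k := by
  rw [natCard_twistedAntitrace_fibre_eq σ hσ ha (maximalIdeal_pow_le_comap σ hσ k) hΔ hc, natCard_fixed_quotient_pow σ hσ ha hq k]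

include hσ in
/-- … and `= 0` when `c + Δσc ∉ 𝔪^k`. [cite: Flicker1998UnitaryFL, Prop. 16 p. 96] -/
theorem natCard_twistedAntitrace_fibre_quotient_pow_eq_zero {Δ : R} (hΔ : Δ * σ Δ = 1) (k : ℕ) {c : R} (hc : c + Δ * σ c ∉ maximalIdeal R ^ k) :
    Nat.card {z : R ⧸ maximalIdeal R ^ k //
        z - Ideal.Quotient.mk _ Δ * Ideal.quotientMap (maximalIdeal R ^ k) σ (maximalIdeal_pow_le_comap σ hσ k) z = Ideal.Quotient.mk _ c} = 0 := by
  haveI := isEmpty_twistedAntitrace_fibre σ hσ (maximalIdeal_pow_le_comap σ hσ k) hΔ hc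
  exact Nat.card_of_isEmpty

end FibresDVR

/-! ## §3 Contraction perturbations of `u ↦ ε·σu` are bijections of `R ⧸ 𝔪^k` -/

section Contraction

variable [IsLocalRing R] (hσ : ∀ a, σ (σ a) = a) (Φ : R → R) {ε : R} (hε : IsUnit ε)
  (hΦ : ∀ (j : ℕ) (u u' : R), u - u' ∈ maximalIdeal R ^ j → Φ u - Φ u' - ε * (σ u - σ u') ∈ maximalIdeal R ^ (j + 1))

include hσ hΦ in
/-- A contraction perturbation `Φ` of `u ↦ εσu` is constant on classes mod `𝔪^k` (`Φu − Φu′ ∈ εσ(u − u′) + 𝔪^{k+1} ⊆ 𝔪^k`).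
[cite: Flicker1998UnitaryFL, Prop. 16 p. 96] -/
theorem sub_mem_of_sub_mem_of_contraction (k : ℕ) {u u' : R} (h : u - u' ∈ maximalIdeal R ^ k) : Φ u - Φ u' ∈ maximalIdeal R ^ k := by
  have h1 := hΦ k u u' h
  have h2 : ε * (σ u - σ u') ∈ maximalIdeal R ^ k := by
    rw [← map_sub]
    exact Ideal.mul_mem_left _ _ (map_mem_maximalIdeal_pow σ hσ k _ h)
  have e : Φ u - Φ u' = (Φ u - Φ u' - ε * (σ u - σ u')) + ε * (σ u - σ u') := by ring
  rw [e]
  exact Ideal.add_mem _ (Ideal.pow_le_pow_right (Nat.le_succ k) h1) h2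

include hσ hΦ in
/-- The class of `Φ u` mod `𝔪^k` depends only on the class of `u`. [cite: Flicker1998UnitaryFL, Prop. 16 p. 96] -/
theorem mk_eq_mk_of_contraction (k : ℕ) {u u' : R} (h : Ideal.Quotient.mk (maximalIdeal R ^ k) u = Ideal.Quotient.mk (maximalIdeal R ^ k) u') :
    Ideal.Quotient.mk (maximalIdeal R ^ k) (Φ u) = Ideal.Quotient.mk (maximalIdeal R ^ k) (Φ u') :=
  (Ideal.Quotient.eq).2 (sub_mem_of_sub_mem_of_contraction σ hσ Φ hΦ k ((Ideal.Quotient.eq).1 h))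

include hσ hε hΦ in
/-- **Injectivity modulo `𝔪^k`**: `Φu − Φu′ ∈ 𝔪^k ⇒ u − u′ ∈ 𝔪^k`, by induction on the level `j ≤ k`: from `u − u′ ∈ 𝔪^j` (`j < k`) one gets
`εσ(u − u′) ∈ 𝔪^k + 𝔪^{j+1} = 𝔪^{j+1}`, hence `u − u′ ∈ 𝔪^{j+1}`. [cite: Flicker1998UnitaryFL, Prop. 16 p. 96] -/
theorem sub_mem_of_contraction (k : ℕ) {u u' : R} (h : Φ u - Φ u' ∈ maximalIdeal R ^ k) : u - u' ∈ maximalIdeal R ^ k := by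
  obtain ⟨εu, rfl⟩ := hε
  have step : ∀ j : ℕ, j < k → u - u' ∈ maximalIdeal R ^ j → u - u' ∈ maximalIdeal R ^ (j + 1) := by
    intro j hj huj
    have h1 := hΦ j u u' huj
    have h2 : (εu : R) * (σ u - σ u') ∈ maximalIdeal R ^ (j + 1) := by
      have e : (εu : R) * (σ u - σ u') = (Φ u - Φ u') - (Φ u - Φ u' - εu * (σ u - σ u')) := by ring
      rw [e]
      exact Ideal.sub_mem _ (Ideal.pow_le_pow_right (by omega) h) h1
    have h3 : σ u - σ u' ∈ maximalIdeal R ^ (j + 1) := by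
      have := Ideal.mul_mem_left _ (↑εu⁻¹ : R) h2
      rwa [← mul_assoc, Units.inv_mul, one_mul] at this
    have h4 := map_mem_maximalIdeal_pow σ hσ (j + 1) _ h3
    rwa [map_sub, hσ, hσ] at h4
  have main : ∀ j : ℕ, j ≤ k → u - u' ∈ maximalIdeal R ^ j := by
    intro j
    induction j with
    | zero => intro _; rw [pow_zero, Ideal.one_eq_top]; exact Submodule.mem_top
    | succ j ih => intro hj; exact step j (by omega) (ih (by omega))
  exact main k le_rfl

include hσ hε hΦ in
/-- **The induced map on `R ⧸ 𝔪^k` is a bijection** (well defined and injective by the two previous lemmas; `R ⧸ 𝔪^k` is finite for a Noetherian local ring with finite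
residue field, ★ `CompleteLocalRing.finite_quotient_maximalIdeal_pow`). [cite: Flicker1998UnitaryFL, Prop. 16 p. 96] -/
theorem bijective_lift_contraction [IsNoetherianRing R] [Finite (ResidueField R)] (k : ℕ) :
    Function.Bijective (fun x : R ⧸ maximalIdeal R ^ k => Ideal.Quotient.mk (maximalIdeal R ^ k) (Φ (Quotient.out x))) := by
  haveI := CompleteLocalRing.finite_quotient_maximalIdeal_pow (R := R) k
  refine Finite.injective_iff_bijective.1 fun x y hxy => ?_
  have hx : Ideal.Quotient.mk (maximalIdeal R ^ k) (Quotient.out x) = x := Quotient.out_eq _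
  have hy : Ideal.Quotient.mk (maximalIdeal R ^ k) (Quotient.out y) = y := Quotient.out_eq _
  rw [← hx, ← hy, Ideal.Quotient.eq]
  exact sub_mem_of_contraction σ hσ Φ hε hΦ k ((Ideal.Quotient.eq).1 hxy)

include hσ hε hΦ in
/-- **Transport of counts along a contraction bijection**: for a predicate `C` on `R` constant on classes mod `𝔪^k`,
`#{ū ∈ R ⧸ 𝔪^k : C(Φ u)} = #{z̄ ∈ R ⧸ 𝔪^k : C z}` (both phrased through lifts). [cite: Flicker1998UnitaryFL, Prop. 16 p. 96] -/
theorem natCard_lift_comp_contraction_eq [IsNoetherianRing R] [Finite (ResidueField R)] (k : ℕ) (C : R → Prop)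
    (hC : ∀ z z' : R, z - z' ∈ maximalIdeal R ^ k → (C z ↔ C z')) :
    Nat.card {x : R ⧸ maximalIdeal R ^ k // ∃ u : R, Ideal.Quotient.mk _ u = x ∧ C (Φ u)} =
      Nat.card {y : R ⧸ maximalIdeal R ^ k // ∃ z : R, Ideal.Quotient.mk _ z = y ∧ C z} := by
  set F := fun x : R ⧸ maximalIdeal R ^ k => Ideal.Quotient.mk (maximalIdeal R ^ k) (Φ (Quotient.out x)) with hF
  have hFb : Function.Bijective F := bijective_lift_contraction σ hσ Φ hε hΦ k
  -- `F (mk u) = mk (Φ u)`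
  have hFmk : ∀ u : R, F (Ideal.Quotient.mk _ u) = Ideal.Quotient.mk _ (Φ u) := fun u =>
    mk_eq_mk_of_contraction σ hσ Φ hΦ k (Quotient.out_eq _)
  -- the predicate on classes
  have hiff : ∀ x : R ⧸ maximalIdeal R ^ k,
      (∃ u : R, Ideal.Quotient.mk _ u = x ∧ C (Φ u)) ↔ (∃ z : R, Ideal.Quotient.mk _ z = F x ∧ C z) := by
    intro x
    constructor
    · rintro ⟨u, rfl, hu⟩
      exact ⟨Φ u, (hFmk u).symm, hu⟩
    · rintro ⟨z, hz, hCz⟩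
      obtain ⟨u, rfl⟩ := Ideal.Quotient.mk_surjective x
      refine ⟨u, rfl, ?_⟩
      rw [hFmk] at hz
      exact (hC z (Φ u) ((Ideal.Quotient.eq).1 hz)).1 hCz
  calc Nat.card {x : R ⧸ maximalIdeal R ^ k // ∃ u : R, Ideal.Quotient.mk _ u = x ∧ C (Φ u)}
      = Nat.card {x : R ⧸ maximalIdeal R ^ k // ∃ z : R, Ideal.Quotient.mk _ z = F x ∧ C z} :=
        Nat.card_congr (Equiv.subtypeEquivRight hiff)
    _ = Nat.card {y : R ⧸ maximalIdeal R ^ k // ∃ z : R, Ideal.Quotient.mk _ z = y ∧ C z} :=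
        Nat.card_congr ((Equiv.ofBijective F hFb).subtypeEquiv fun x => Iff.rfl)

end Contraction

/-! ## §4 Level lifting: `#{x̄ ∈ R ⧸ 𝔪^m : C} = |𝓀|^{m−k} · #{ȳ ∈ R ⧸ 𝔪^k : C}` for `C` constant mod `𝔪^k`, `k ≤ m` -/

section Lift

/-- Counting along a SURJECTIVE additive homomorphism of finite groups: `#{a : Q (f a)} = |ker f| · #{b : Q b}` (a section `s` gives the bijection
`(b, κ) ↦ s b + κ`). [folklore] -/
private theorem natCard_subtype_comp_eq_of_surjective {A B : Type*} [AddCommGroup A] [AddCommGroup B] (f : A →+ B) (hf : Function.Surjective f)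
    (Q : B → Prop) : Nat.card {x : A // Q (f x)} = Nat.card f.ker * Nat.card {y : B // Q y} := by
  classical
  choose s hs using hf
  rw [mul_comm, ← Nat.card_prod]
  refine Nat.card_congr
    { toFun := fun x => (⟨f x.1, x.2⟩, ⟨x.1 - s (f x.1), by rw [AddMonoidHom.mem_ker, map_sub, hs, sub_self]⟩)
      invFun := fun p => ⟨s p.1.1 + p.2.1, by
        show Q (f (s p.1.1 + p.2.1))
        rw [map_add, hs, (AddMonoidHom.mem_ker).1 p.2.2, add_zero]; exact p.1.2⟩
      left_inv := fun x => Subtype.ext (by simp)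
      right_inv := fun p => by
        have h2 : f p.2.1 = 0 := (AddMonoidHom.mem_ker).1 p.2.2
        refine Prod.ext (Subtype.ext ?_) (Subtype.ext ?_)
        · show f (s p.1.1 + p.2.1) = p.1.1
          rw [map_add, hs, h2, add_zero]
        · show s p.1.1 + p.2.1 - s (f (s p.1.1 + p.2.1)) = p.2.1
          rw [map_add, hs, h2, add_zero]; abel }

variable [IsDomain R] [IsDiscreteValuationRing R] [Finite (ResidueField R)]

/-- The kernel of `R ⧸ 𝔪^m → R ⧸ 𝔪^k` (`k ≤ m`) has `|𝓀|^{m−k}` elements. [cite: Serre1979, Ch. II §3 Prop. 5] -/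
theorem natCard_ker_factor_quotient_pow {k m : ℕ} (hkm : k ≤ m) :
    Nat.card (Ideal.Quotient.factor (Ideal.pow_le_pow_right hkm : maximalIdeal R ^ m ≤ maximalIdeal R ^ k)).toAddMonoidHom.ker =
      Nat.card (ResidueField R) ^ (m - k) := by
  haveI := CompleteLocalRing.finite_quotient_maximalIdeal_pow (R := R) m
  have hle : maximalIdeal R ^ m ≤ maximalIdeal R ^ k := Ideal.pow_le_pow_right hkm
  set φ := Ideal.Quotient.factor hle with hφ
  have hsurj : Function.Surjective φ.toAddMonoidHom := fun y => by
    obtain ⟨y, rfl⟩ := Ideal.Quotient.mk_surjective y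
    exact ⟨Ideal.Quotient.mk _ y, Ideal.Quotient.factor_mk hle y⟩
  have hcard : Nat.card (R ⧸ maximalIdeal R ^ m) = Nat.card (R ⧸ maximalIdeal R ^ k) * Nat.card φ.toAddMonoidHom.ker := by
    rw [AddSubgroup.card_eq_card_quotient_mul_card_addSubgroup φ.toAddMonoidHom.ker,
      Nat.card_congr (QuotientAddGroup.quotientKerEquivOfSurjective φ.toAddMonoidHom hsurj).toEquiv]
  rw [natCard_quotient_maximalIdeal_pow, natCard_quotient_maximalIdeal_pow] at hcard
  have hq : 0 < Nat.card (ResidueField R) ^ k := pow_pos Nat.card_pos k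
  obtain ⟨j, rfl⟩ := Nat.exists_eq_add_of_le hkm
  rw [Nat.add_sub_cancel_left]
  rw [pow_add] at hcard
  exact (Nat.eq_of_mul_eq_mul_left hq hcard).symm

/-- **Level lifting of counts**: for `k ≤ m` and a predicate `C` on `R` that is constant on classes mod `𝔪^k`,
`#{x̄ ∈ R ⧸ 𝔪^m : C} = |𝓀|^{m−k} · #{ȳ ∈ R ⧸ 𝔪^k : C}` (both phrased through lifts). [cite: Serre1979, Ch. II §3 Prop. 5] [cite: Flicker1998UnitaryFL, Prop. 16 p. 96] -/
theorem natCard_lift_quotient_pow_eq_mul {k m : ℕ} (hkm : k ≤ m) (C : R → Prop) (hC : ∀ z z' : R, z - z' ∈ maximalIdeal R ^ k → (C z ↔ C z')) :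
    Nat.card {x : R ⧸ maximalIdeal R ^ m // ∃ u : R, Ideal.Quotient.mk _ u = x ∧ C u} =
      Nat.card (ResidueField R) ^ (m - k) * Nat.card {y : R ⧸ maximalIdeal R ^ k // ∃ u : R, Ideal.Quotient.mk _ u = y ∧ C u} := by
  have hle : maximalIdeal R ^ m ≤ maximalIdeal R ^ k := Ideal.pow_le_pow_right hkm
  set φ := Ideal.Quotient.factor hle with hφ
  have hsurj : Function.Surjective φ.toAddMonoidHom := fun y => by
    obtain ⟨y, rfl⟩ := Ideal.Quotient.mk_surjective y
    exact ⟨Ideal.Quotient.mk _ y, Ideal.Quotient.factor_mk hle y⟩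
  rw [← natCard_ker_factor_quotient_pow hkm,
    ← natCard_subtype_comp_eq_of_surjective φ.toAddMonoidHom hsurj (fun y => ∃ u : R, Ideal.Quotient.mk _ u = y ∧ C u)]
  refine Nat.card_congr (Equiv.subtypeEquivRight fun x => ?_)
  obtain ⟨x, rfl⟩ := Ideal.Quotient.mk_surjective x
  change (∃ u : R, Ideal.Quotient.mk (maximalIdeal R ^ m) u = Ideal.Quotient.mk (maximalIdeal R ^ m) x ∧ C u) ↔
    (∃ u : R, Ideal.Quotient.mk (maximalIdeal R ^ k) u = φ (Ideal.Quotient.mk (maximalIdeal R ^ m) x) ∧ C u)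
  rw [hφ, Ideal.Quotient.factor_mk]
  constructor
  · rintro ⟨u, hu, hCu⟩
    exact ⟨u, by rw [← Ideal.Quotient.factor_mk hle u, hu, Ideal.Quotient.factor_mk], hCu⟩
  · rintro ⟨u, hu, hCu⟩
    exact ⟨x, rfl, (hC u x ((Ideal.Quotient.eq).1 hu)).1 hCu⟩

end Lift

end Literature.NumberTheory.LocalFields.UnramifiedQuadraticNorm
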